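import Summits.HodgeConjecture.HodgeConjecture.Theses.SplitMonadSeeds
import Literature.AlgebraicGeometry.Motives.AbelianVarietyExistence

/-!
# `SplitMonadSeeds.InnerFormAnchors` (stmt-HodgeConjecture-25517) — its construction content, kernel-checked

Support item `InnerFormAnchors := ∀ A : AbelianVariety ℂ, PadicAnchor.InnerFormAnchorsFor A` of route
`HodgeConjecture/SplitMonadSeeds` (shared with the abelian glue `h₁` of route `PadicSemiregularLift`).
The statement is true in print (Kisin 2017, §2.1 (2.1.2), Cor. 2.3.2, 2.3.5; Kisin–Madapusi Pera–Shin
2022; Deligne 1982; fixed-part theorem), but its last conjunct `∃ D : PadicAnchor.Anchor A.dim X,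
D.IsGenuine ∧ D.SpansHodge` asks for a VALUE of the hypothesis structure
`PadicAnchor.Anchor ⊇ (C : CrystallineRealization p k) ⊇ WeilCohomology k K(p, k)` over an
algebraically closed field `k` of characteristic `p > dim A + 6`. This file records, as theorems,
exactly what any proof of the item must therefore CONSTRUCT (the standing debt C1–C2 of the crux
notes `Cruxes/HodgeAbelianVarieties/NOTES.md`, drefute `NegativeNotesG2StubInnerFormAnchors.md`):

* `exists_crystallineRealization_of_innerFormAnchorsFor` — an inner-form anchor of `A` yields a
  crystalline realization (hence a Weil cohomology theory with coefficients `K(p, k) = W(k)[1/p]`,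
  `nonempty_weilCohomology_of_innerFormAnchorsFor`) over an algebraically closed field of some
  characteristic `p > dim A + 6`, together with a smooth proper `W(k)`-model of relative dimension
  `dim A` (`exists_isSmoothProperModel_of_innerFormAnchorsFor`);
* `exists_classicalPackage_of_innerFormAnchorsFor` — at that realization the named-fact predicates
  `BerthelotOgusLineBundleLifting`, `BlochEsnaultKerzLifting`, `SpecializationOfCycles` hold (the item
  discharges them by construction: fields of `Anchor.IsGenuine`);
* `exists_crystallineRealization_of_innerFormAnchors` — since abelian varieties of every dimension
  exist over `ℂ` (`exists_abelianVariety_dim_eq_succ`), the item `InnerFormAnchors` yields crystalline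
  realizations over algebraically closed fields of ARBITRARILY LARGE characteristic.

Neither Mathlib nor the tree constructs any value of `WeilCohomology k K` for `k` of positive
characteristic (crystalline cohomology as a Weil cohomology theory: Berthelot 1974, Katz–Messing 1974,
Gillet–Messing 1987), so the item is construction-blocked, not in doubt. Nothing here asserts or refutes
a Theses declaration; no definition, no named fact, no `sorry`.
-/

-- `Summit.HodgeConjecture.HodgeConjecture.…` repeats the summit name by the D-0017 layout (Sub = Summit), so the
-- dupNamespace linter is silenced for this file (CONVENTIONS §1).
set_option linter.dupNamespace false

noncomputable section

open CategoryTheory AlgebraicGeometry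
open scoped Isocrystal
open Literature.AlgebraicGeometry.Motives Literature.AlgebraicGeometry.Crystalline.PadicAnchor

namespace Summit.HodgeConjecture.HodgeConjecture.Theorems.SplitMonadSeeds.InnerFormAnchorsDebt

/-- **An inner-form anchor carries a crystalline realization.** If the complex abelian variety `A`
has an inner-form anchor (`InnerFormAnchorsFor A`), then for some prime `p` with `dim A + 6 < p` and
some algebraically closed (perfect) field `k` of characteristic `p` there is a value of the
hypothesis structure `CrystallineRealization p k` — the anchor's own realization `D.C`. [folklore] -/
theorem exists_crystallineRealization_of_innerFormAnchorsFor {A : AbelianVariety ℂ}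
    (h : InnerFormAnchorsFor A) :
    ∃ (p : ℕ) (_ : Fact p.Prime) (k : Type) (_ : Field k) (_ : CharP k p) (_ : PerfectRing k p)
      (_ : IsAlgClosed k), A.dim + 6 < p ∧ Nonempty (CrystallineRealization p k) := by
  obtain ⟨σ, 𝒳₀, S₀, f₀, t, s, eA, -, -, -, -, -, D, -, -⟩ := h
  exact ⟨D.p, D.prime, D.k, D.field, D.charP, D.perfect, D.algClosed, D.large, ⟨D.C⟩⟩

/-- **An inner-form anchor carries a Weil cohomology theory in positive characteristic**: under
`InnerFormAnchorsFor A` there is a Weil cohomology theory on smooth projective `k`-varieties with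
coefficients in `K(p, k) = W(k)[1/p]`, for some algebraically closed `k` of some characteristic
`p > dim A + 6` (the rational crystalline theory underlying the anchor's realization). [folklore] -/
theorem nonempty_weilCohomology_of_innerFormAnchorsFor {A : AbelianVariety ℂ}
    (h : InnerFormAnchorsFor A) :
    ∃ (p : ℕ) (_ : Fact p.Prime) (k : Type) (_ : Field k) (_ : CharP k p) (_ : PerfectRing k p)
      (_ : IsAlgClosed k), A.dim + 6 < p ∧ Nonempty (WeilCohomology k K(p, k)) := by
  obtain ⟨p, hp, k, hk, hc, hP, hA, hlt, ⟨C⟩⟩ := exists_crystallineRealization_of_innerFormAnchorsFor h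
  exact ⟨p, hp, k, hk, hc, hP, hA, hlt, ⟨C.toWeilCohomology⟩⟩

/-- **An inner-form anchor carries a smooth proper `W(k)`-model** of relative dimension `dim A` whose
special fibre underlies a supersingular abelian variety over `k` (the anchor's model `D.𝒴`, `D.A₀`).
[folklore] -/
theorem exists_isSmoothProperModel_of_innerFormAnchorsFor {A : AbelianVariety ℂ}
    (h : InnerFormAnchorsFor A) :
    ∃ (p : ℕ) (_ : Fact p.Prime) (k : Type) (_ : Field k) (_ : CharP k p) (_ : PerfectRing k p)
      (_ : IsAlgClosed k) (𝒴 : SchemeOver (WittVector p k)) (A₀ : AbelianVariety k),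
      A.dim + 6 < p ∧ WittScheme.IsSmoothProperModel A.dim 𝒴 ∧
        A₀.X = WittScheme.specialFibre 𝒴 ∧ A₀.IsSupersingular := by
  obtain ⟨σ, 𝒳₀, S₀, f₀, t, s, eA, -, -, -, -, -, D, -, -⟩ := h
  exact ⟨D.p, D.prime, D.k, D.field, D.charP, D.perfect, D.algClosed, D.𝒴, D.A₀, D.large, D.model,
    D.special_eq, D.supersingular⟩

/-- **An inner-form anchor discharges, by construction, Berthelot–Ogus 3.8, Bloch–Esnault–Kerz 1.3
and specialization of cycles at its realization**: `InnerFormAnchorsFor A` yields a crystalline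
realization `C` over an algebraically closed field of some characteristic `p > dim A + 6` for which the
tree's three named-fact PREDICATES `C.BerthelotOgusLineBundleLifting` (Berthelot–Ogus 1983, Thm. 3.8),
`BlochEsnaultKerzLifting C` (Bloch–Esnault–Kerz 2014, Thm. 1.3) and `SpecializationOfCycles C`
(Fulton §20.3) all HOLD — so a proof of the item not only constructs `C` but proves these three
theorems for it (fields `lineBundles`, `bek`, `specialization` of `Anchor.IsGenuine`). [folklore] -/
theorem exists_classicalPackage_of_innerFormAnchorsFor {A : AbelianVariety ℂ}
    (h : InnerFormAnchorsFor A) :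
    ∃ (p : ℕ) (_ : Fact p.Prime) (k : Type) (_ : Field k) (_ : CharP k p) (_ : PerfectRing k p)
      (_ : IsAlgClosed k) (C : CrystallineRealization p k), A.dim + 6 < p ∧
        C.BerthelotOgusLineBundleLifting ∧ Literature.AlgebraicGeometry.Crystalline.BlochEsnaultKerzLifting C ∧
          SpecializationOfCycles C := by
  obtain ⟨σ, 𝒳₀, S₀, f₀, t, s, eA, -, -, -, -, -, D, hD, -⟩ := h
  exact ⟨D.p, D.prime, D.k, D.field, D.charP, D.perfect, D.algClosed, D.C, D.large, hD.lineBundles,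
    hD.bek, hD.specialization⟩

/-- **The item `InnerFormAnchors` yields crystalline realizations in arbitrarily large
characteristic**: abelian varieties of every dimension `g + 1` exist over `ℂ`
(`exists_abelianVariety_dim_eq_succ`), and an inner-form anchor of one of dimension `g + 1` lives in
characteristic `p > g + 7`. So any proof of stmt-HodgeConjecture-25517 constructs, for infinitely many
primes `p`, a value of `CrystallineRealization p k` over an algebraically closed field `k` of
characteristic `p`. [folklore] -/
theorem exists_crystallineRealization_of_innerFormAnchors
    (h : Theses.SplitMonadSeeds.InnerFormAnchors) (g : ℕ) :
    ∃ (p : ℕ) (_ : Fact p.Prime) (k : Type) (_ : Field k) (_ : CharP k p) (_ : PerfectRing k p)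
      (_ : IsAlgClosed k), g + 7 < p ∧ Nonempty (CrystallineRealization p k) := by
  obtain ⟨A, hA⟩ := exists_abelianVariety_dim_eq_succ ℂ g
  obtain ⟨p, hp, k, hk, hc, hP, hA', hlt, hC⟩ := exists_crystallineRealization_of_innerFormAnchorsFor (h A)
  exact ⟨p, hp, k, hk, hc, hP, hA', by omega, hC⟩

/-- **… and Weil cohomology theories in arbitrarily large characteristic.** [folklore] -/
theorem nonempty_weilCohomology_of_innerFormAnchors
    (h : Theses.SplitMonadSeeds.InnerFormAnchors) (g : ℕ) :
    ∃ (p : ℕ) (_ : Fact p.Prime) (k : Type) (_ : Field k) (_ : CharP k p) (_ : PerfectRing k p)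
      (_ : IsAlgClosed k), g + 7 < p ∧ Nonempty (WeilCohomology k K(p, k)) := by
  obtain ⟨A, hA⟩ := exists_abelianVariety_dim_eq_succ ℂ g
  obtain ⟨p, hp, k, hk, hc, hP, hA', hlt, hW⟩ := nonempty_weilCohomology_of_innerFormAnchorsFor (h A)
  exact ⟨p, hp, k, hk, hc, hP, hA', by omega, hW⟩

end Summit.HodgeConjecture.HodgeConjecture.Theorems.SplitMonadSeeds.InnerFormAnchorsDebt

end
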